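import Summits.Langlands.Langlands.Theorems.ParityBlindBianchiResidualBianchiDoorMod2TwoAdicModel
import Literature.NumberTheory.Automorphic.BaseChangeCyclicCuspidal
import Literature.NumberTheory.Automorphic.BaseChangeStrongAllFinite
import Literature.NumberTheory.Automorphic.BaseChangeArchimedeanProofs
import Literature.NumberTheory.Automorphic.GLnAdelicStructureProofs
import Literature.NumberTheory.GaloisRepresentations.ArtinFormalismInductionProofs
import Literature.NumberTheory.Automorphic.ReciprocityGLn
import Literature.NumberTheory.Automorphic.TunnellOctahedralLocal
import HarnessLib

/-!
# Stub stub_bcTransfer of line Sketch (crux stmt-Langlands-15112 `ParityBlindBianchi.ResidualBianchiDoorLevel`)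

The uniform-in-`K` strong quadratic base change of the ℚ-level congruence package.  Granted the
three named facts of Arthur–Clozel (taken as hypotheses, never restated):
`baseChange_cyclic_cuspidal` (Ch. 3, Thm. 4.2 (a): the weak lift of a cuspidal `π` not fixed by the
quadratic twist is cuspidal), `ArthurClozel1989_strongLifting_archimedean` (Thm. 5.1 at the
archimedean places: infinity types restrict, so regular algebraicity ascends) and
`ArthurClozel1989_strongLifting_allFinite` (Thm. 5.1 at ALL finite places: `t_{Π,w} = t_{π,v}^{f(w|v)}`,
also over the places ramified in `K/ℚ`), we transfer, for a quadratic field `K`, a regular algebraic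
cuspidal `π` on `GL₂(𝔸_ℚ)` congruent (coefficientwise in `𝔪_{ℤ̄₂}`, in the C-normalisation `m = 2`
of `arithFrobPolyOfSatake`) to `σ₀ : Γ_ℚ → GL₂(ℚ̄₂)` at every place over no prime of `S`, to a regular
algebraic cuspidal `Π = BC_K(π)` on `GL₂(𝔸_K)` congruent to `σ₀|_{Γ_K}` at every place `w` of `K`
over no prime of `S` — split, inert or ramified.

* `norm_coeff_sub_lt_one_iff` — for monic quadratics `(X - a)(X - b)`, `(X - r)(X - s)` the
  coefficientwise congruence is the pair of congruences `ab ≡ rs`, `a + b ≡ r + s`;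
* `norm_sq_congr_of_norm_le_one` — the ultrametric estimate: if `a, b` are integral and
  `ab ≡ rs`, `a + b ≡ r + s (mod 𝔪)`, then `a²b² ≡ r²s²` and `a² + b² ≡ r² + s²`;
* `arithFrobPolyOfSatake_two_eq`, `arithFrobPolyOfSatake_sq_two_eq` — the `m = 2` prediction at
  `q` has roots `ι⁻¹((√q·x)⁻¹)`, and at `q²` for the squared multiset its roots are their squares;
* `arithFrobPolyOfSatake_congr_sq` — the congruence at `v` propagates to the inert place (`f = 2`);
* `stub_bcTransfer` — the registered stub.
-/

noncomputable section

open scoped MatrixGroups Polynomial Valued Classical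
open Polynomial NumberField IsDedekindDomain Filter
open Literature.NumberTheory.Automorphic Literature.NumberTheory.GaloisRepresentations

namespace Summit.Langlands.Langlands.Cruxes.ResidualBianchiDoorLevel.Sketch

set_option linter.dupNamespace false

/-! ### Monic quadratics: coefficientwise congruence -/

/-- The difference of two monic quadratics `(X - a)(X - b) - (X - r)(X - s)` is the linear
polynomial `((r + s) - (a + b)) X + (ab - rs)`. [folklore] -/
theorem X_sub_C_mul_X_sub_C_sub {L : Type*} [CommRing L] (a b r s : L) :
    (X - C a) * (X - C b) - (X - C r) * (X - C s) =
      C ((r + s) - (a + b)) * X + C (a * b - r * s) := by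
  simp only [map_sub, map_add, map_mul]
  ring

/-- For monic quadratics `(X - a)(X - b)` and `(X - r)(X - s)` over a normed field, all
coefficients are within distance `< 1` iff `‖ab - rs‖ < 1` and `‖(r + s) - (a + b)‖ < 1`
(the coefficients in degree `≥ 2` agree). [folklore] -/
theorem norm_coeff_sub_lt_one_iff {L : Type*} [NormedField L] (a b r s : L) :
    (∀ i : ℕ, ‖((X - C a) * (X - C b)).coeff i - ((X - C r) * (X - C s)).coeff i‖ < 1) ↔
      ‖a * b - r * s‖ < 1 ∧ ‖(r + s) - (a + b)‖ < 1 := by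
  have key : ∀ i : ℕ, ((X - C a) * (X - C b)).coeff i - ((X - C r) * (X - C s)).coeff i =
      (C ((r + s) - (a + b)) * X + C (a * b - r * s)).coeff i := fun i => by
    rw [← coeff_sub, X_sub_C_mul_X_sub_C_sub]
  refine ⟨fun h => ⟨?_, ?_⟩, fun h i => ?_⟩
  · have h0 := h 0
    rwa [key, coeff_add, coeff_C_mul_X, coeff_C, if_neg Nat.zero_ne_one, if_pos rfl,
      zero_add] at h0
  · have h1 := h 1
    rwa [key, coeff_add, coeff_C_mul_X, coeff_C, if_pos rfl, if_neg Nat.one_ne_zero,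
      add_zero] at h1
  · rw [key, coeff_add, coeff_C_mul_X, coeff_C]
    rcases i with _ | _ | i
    · simpa using h.1
    · simpa using h.2
    · simp

/-- **Ultrametric propagation of a congruence to squares.**  In an ultrametric normed field, if
`‖a‖, ‖b‖ ≤ 1` and `ab ≡ rs`, `a + b ≡ r + s` modulo the maximal ideal `{‖·‖ < 1}`, then
`a²b² ≡ r²s²` and `a² + b² ≡ r² + s²`: `a²b² - r²s² = (ab - rs)(ab + rs)` with
`ab + rs = 2ab - (ab - rs)` integral, and
`(a² + b²) - (r² + s²) = ((a+b) - (r+s))((a+b) + (r+s)) - 2(ab - rs)`. [folklore] -/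
theorem norm_sq_congr_of_norm_le_one {L : Type*} [NormedField L] [IsUltrametricDist L]
    {a b r s : L} (ha : ‖a‖ ≤ 1) (hb : ‖b‖ ≤ 1) (h0 : ‖a * b - r * s‖ < 1)
    (h1 : ‖(r + s) - (a + b)‖ < 1) :
    ‖a ^ 2 * b ^ 2 - r ^ 2 * s ^ 2‖ < 1 ∧ ‖(r ^ 2 + s ^ 2) - (a ^ 2 + b ^ 2)‖ < 1 := by
  have h2 : ‖(2 : L)‖ ≤ 1 := by simpa using IsUltrametricDist.norm_natCast_le_one L 2
  have hsub : ∀ x y : L, ‖x - y‖ ≤ max ‖x‖ ‖y‖ := fun x y => by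
    simpa [sub_eq_add_neg, norm_neg] using IsUltrametricDist.norm_add_le_max x (-y)
  have hab : ‖a * b‖ ≤ 1 := by
    rw [norm_mul]; exact mul_le_one₀ ha (norm_nonneg _) hb
  have hapb : ‖a + b‖ ≤ 1 := (IsUltrametricDist.norm_add_le_max a b).trans (max_le ha hb)
  -- `ab + rs = 2ab - (ab - rs)` is integral
  have hplus0 : ‖a * b + r * s‖ ≤ 1 := by
    have : a * b + r * s = 2 * (a * b) - (a * b - r * s) := by ring
    rw [this]
    refine (hsub _ _).trans (max_le ?_ h0.le)
    rw [norm_mul]; exact mul_le_one₀ h2 (norm_nonneg _) hab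
  -- `(a + b) + (r + s) = 2(a + b) + ((r + s) - (a + b))` is integral
  have hplus1 : ‖(a + b) + (r + s)‖ ≤ 1 := by
    have : (a + b) + (r + s) = 2 * (a + b) + ((r + s) - (a + b)) := by ring
    rw [this]
    refine (IsUltrametricDist.norm_add_le_max _ _).trans (max_le ?_ h1.le)
    rw [norm_mul]; exact mul_le_one₀ h2 (norm_nonneg _) hapb
  refine ⟨?_, ?_⟩
  · have : a ^ 2 * b ^ 2 - r ^ 2 * s ^ 2 = (a * b - r * s) * (a * b + r * s) := by ring
    rw [this, norm_mul]
    calc ‖a * b - r * s‖ * ‖a * b + r * s‖ ≤ ‖a * b - r * s‖ * 1 :=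
          mul_le_mul_of_nonneg_left hplus0 (norm_nonneg _)
      _ < 1 := by rw [mul_one]; exact h0
  · have : (r ^ 2 + s ^ 2) - (a ^ 2 + b ^ 2) =
        ((r + s) - (a + b)) * ((a + b) + (r + s)) - 2 * (r * s - a * b) := by ring
    rw [this]
    refine lt_of_le_of_lt (hsub _ _) (max_lt ?_ ?_)
    · rw [norm_mul]
      calc ‖(r + s) - (a + b)‖ * ‖(a + b) + (r + s)‖ ≤ ‖(r + s) - (a + b)‖ * 1 :=
            mul_le_mul_of_nonneg_left hplus1 (norm_nonneg _)
        _ < 1 := by rw [mul_one]; exact h1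
    · rw [norm_mul, ← norm_neg (r * s - a * b), neg_sub]
      calc ‖(2 : L)‖ * ‖a * b - r * s‖ ≤ 1 * ‖a * b - r * s‖ :=
            mul_le_mul_of_nonneg_right h2 (norm_nonneg _)
        _ < 1 := by rw [one_mul]; exact h0

/-- Squares of monic quadratics stay congruent: if `a, b` are integral and `(X - a)(X - b)` is
coefficientwise congruent to `(X - r)(X - s)`, then `(X - a²)(X - b²)` is coefficientwise
congruent to `(X - r²)(X - s²)`. [folklore] -/
theorem norm_coeff_sq_sub_lt_one {L : Type*} [NormedField L] [IsUltrametricDist L]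
    {a b r s : L} (ha : ‖a‖ ≤ 1) (hb : ‖b‖ ≤ 1)
    (h : ∀ i : ℕ, ‖((X - C a) * (X - C b)).coeff i - ((X - C r) * (X - C s)).coeff i‖ < 1) :
    ∀ i : ℕ, ‖((X - C (a ^ 2)) * (X - C (b ^ 2))).coeff i -
      ((X - C (r ^ 2)) * (X - C (s ^ 2))).coeff i‖ < 1 := by
  rw [norm_coeff_sub_lt_one_iff] at h ⊢
  exact norm_sq_congr_of_norm_le_one ha hb h.1 h.2

/-! ### The `m = 2` prediction at `q` and at `q²` -/

/-- The `m = 2` predicted polynomial at residue cardinality `q`: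
`∏_{x ∈ α} (X - ι⁻¹((√q · x)⁻¹))`. [cite: HarrisLanTaylorThorneRMS2016, Thm. A] -/
theorem arithFrobPolyOfSatake_two_eq {ℓ : ℕ} [Fact ℓ.Prime] (ι : PadicAlgCl ℓ ≃+* ℂ) (q : ℕ)
    (α : Multiset ℂ) :
    arithFrobPolyOfSatake ι q 2 α =
      (α.map fun x ↦ X - C (ι.symm (((Real.sqrt q : ℝ) : ℂ) * x)⁻¹)).prod := by
  simp [arithFrobPolyOfSatake]

/-- The `m = 2` predicted polynomial at residue cardinality `q²` of the squared multiset has as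
roots the squares of the roots at `q`: `√(q²) · x² = (√q · x)²`.
[cite: HarrisLanTaylorThorneRMS2016, Thm. A] -/
theorem arithFrobPolyOfSatake_sq_two_eq {ℓ : ℕ} [Fact ℓ.Prime] (ι : PadicAlgCl ℓ ≃+* ℂ) (q : ℕ)
    (α : Multiset ℂ) :
    arithFrobPolyOfSatake ι (q ^ 2) 2 (α.map (· ^ 2)) =
      (α.map fun x ↦ X - C ((ι.symm (((Real.sqrt q : ℝ) : ℂ) * x)⁻¹) ^ 2)).prod := by
  have hq : ((Real.sqrt ((q ^ 2 : ℕ) : ℝ) : ℝ) : ℂ) = (((Real.sqrt q : ℝ)) : ℂ) ^ 2 := by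
    rw [Nat.cast_pow, Real.sqrt_sq (Nat.cast_nonneg _), ← Complex.ofReal_pow,
      Real.sq_sqrt (Nat.cast_nonneg _)]
  rw [arithFrobPolyOfSatake_two_eq, Multiset.map_map]
  congr 1
  refine Multiset.map_congr rfl fun x _ => ?_
  simp only [Function.comp_apply]
  rw [hq, ← mul_pow, ← inv_pow, map_pow]

/-- **The congruence propagates to an inert place.**  If `charpoly σ₀(Frob_v) = (X - a)(X - b)`
with `a, b ∈ ℤ̄_ℓ` is coefficientwise congruent to the `m = 2` prediction of a Satake pair `α` at
`q = q_v`, then `(X - a²)(X - b²) = charpoly σ₀(Frob_v²)` is coefficientwise congruent to the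
prediction of `α² = t_{Π,w}` at `q_w = q_v²`. [folklore] -/
theorem arithFrobPolyOfSatake_congr_sq {ℓ : ℕ} [Fact ℓ.Prime] (ι : PadicAlgCl ℓ ≃+* ℂ) {q : ℕ}
    {α : Multiset ℂ} (hα : Multiset.card α = 2) {a b : PadicAlgCl ℓ} (ha : ‖a‖ ≤ 1)
    (hb : ‖b‖ ≤ 1)
    (h : ∀ i : ℕ, ‖((X - C a) * (X - C b)).coeff i - (arithFrobPolyOfSatake ι q 2 α).coeff i‖ < 1) :
    ∀ i : ℕ, ‖((X - C (a ^ 2)) * (X - C (b ^ 2))).coeff i -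
      (arithFrobPolyOfSatake ι (q ^ 2) 2 (α.map (· ^ 2))).coeff i‖ < 1 := by
  obtain ⟨x, y, rfl⟩ := Multiset.card_eq_two.mp hα
  rw [arithFrobPolyOfSatake_two_eq] at h
  rw [arithFrobPolyOfSatake_sq_two_eq]
  simp only [Multiset.insert_eq_cons, Multiset.map_cons, Multiset.map_singleton,
    Multiset.prod_cons, Multiset.prod_singleton] at h ⊢
  exact norm_coeff_sq_sub_lt_one ha hb h

/-! ### The stub -/

/-- **Stub `stub_bcTransfer` (uniform-in-`K` strong quadratic base change of the ℚ-level package).**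
Granted Arthur–Clozel Thm 4.2 (a) (`baseChange_cyclic_cuspidal`), Thm 5.1 archimedean
(`ArthurClozel1989_strongLifting_archimedean`) and Thm 5.1 at all finite places
(`ArthurClozel1989_strongLifting_allFinite`): for `σ₀, S, π` as in `stub_qLevel`, a quadratic field
`K` (Galois of prime degree `2`) and a non-twist witness at an inert place (the conclusion of
`stub_cuspWitness`), the cuspidal weak lift `Π = BC_K(π)` is regular algebraic
(`isRegularAlgebraic_baseChange`) and at EVERY place `w` of `K` over a prime `p ∉ S` (split, inert or
ramified in `K`), with `v` the place of `ℚ` below `w` and `f = f(w|v) ∈ {1, 2}`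
(`inertiaDeg_eq_one_or_two_of_finrank_eq_two`): `Π` has Satake parameter `α^f` (R1), `σ₀|_{Γ_K}` is
unramified at `w` with `charpoly σ₀|_K(Frob_w) = (X - a^f)(X - b^f)` (`isUnramifiedAt_restrictField`,
`hasFrobCharpolyAt_restrictField_fin_two`), and the congruence propagates since `q_w = q_v^f`
(`residueCard_eq_pow_inertiaDeg_of_under_eq`), the roots of the `f = 2` prediction being the squares
of those of the `f = 1` prediction and `a, b` being integral (ultrametric estimates for
`a² + b² = (a+b)² - 2ab`, `a²b²`).  `hcpt` for `K` is `isCompact_glFiniteIntegralLevel_holds`.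
[cite: ArthurClozelAMS120, Ch. 3 Thm. 4.2 (a) and Thm. 5.1] -/
theorem stub_bcTransfer
    (hBC : baseChange_cyclic_cuspidal) (hArch : ArthurClozel1989_strongLifting_archimedean)
    (hR1 : ArthurClozel1989_strongLifting_allFinite)
    (ι : PadicAlgCl 2 ≃+* ℂ) (σ₀ : FramedGaloisRep ℚ (PadicAlgCl 2) 2)
    (S : Finset ℕ) (hcptQ : isCompact_glFiniteIntegralLevel 2 ℚ)
    (πQ : CuspidalAutomorphicRepData 2 ℚ hcptQ) (hRA : πQ.1.IsRegularAlgebraic)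
    (hgood : ∀ v : HeightOneSpectrum (𝓞 ℚ), (∀ ℓ ∈ S, ((ℓ : ℕ) : 𝓞 ℚ) ∉ v.asIdeal) →
      ∃ (α : Multiset ℂ) (a b : PadicAlgCl 2), ‖a‖ ≤ 1 ∧ ‖b‖ ≤ 1 ∧
        πQ.1.HasSatakeParamAt v α ∧ σ₀.IsUnramifiedAt v ∧
        σ₀.HasFrobCharpolyAt v ((X - C a) * (X - C b)) ∧
        ∀ i : ℕ, ‖((X - C a) * (X - C b)).coeff i -
          (arithFrobPolyOfSatake ι v.residueCard 2 α).coeff i‖ < 1)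
    (K : Type) [Field K] [NumberField K] (hK : Module.finrank ℚ K = 2)
    (hne : ∃ (v : HeightOneSpectrum (𝓞 ℚ)) (w : HeightOneSpectrum (𝓞 K)) (α : Multiset ℂ),
      w.asIdeal.under (𝓞 ℚ) = v.asIdeal ∧ w.asIdeal.inertiaDeg (𝓞 ℚ) = Module.finrank ℚ K ∧
      πQ.1.HasSatakeParamAt v α ∧
      ∀ ζ : ℂ, IsPrimitiveRoot ζ (Module.finrank ℚ K) → α.map (ζ * ·) ≠ α) :
    ∃ (hcpt : isCompact_glFiniteIntegralLevel 2 K) (π₀ : CuspidalAutomorphicRepData 2 K hcpt),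
      π₀.1.IsRegularAlgebraic ∧
        ∀ w : HeightOneSpectrum (𝓞 K), (∀ ℓ ∈ S, ((ℓ : ℕ) : 𝓞 K) ∉ w.asIdeal) →
          ∃ (α : Multiset ℂ) (P : Polynomial (PadicAlgCl 2)), π₀.1.HasSatakeParamAt w α ∧
            (σ₀.restrictField K).IsUnramifiedAt w ∧ (σ₀.restrictField K).HasFrobCharpolyAt w P ∧
            ∀ i : ℕ, ‖P.coeff i - (arithFrobPolyOfSatake ι w.residueCard 2 α).coeff i‖ < 1 := by
  -- (1) `K/ℚ` is Galois, cyclic, of prime degree `2`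
  haveI : Algebra.IsQuadraticExtension ℚ K := ⟨hK⟩
  haveI : IsGalois ℚ K := inferInstance
  have hprime : (Module.finrank ℚ K).Prime := hK ▸ Nat.prime_two
  have hcyc : IsCyclic (K ≃ₐ[ℚ] K) := inferInstance
  -- (2) the cuspidal weak lift `Π = BC_K(π)`, regular algebraic
  have hcpt : isCompact_glFiniteIntegralLevel 2 K := isCompact_glFiniteIntegralLevel_holds 2 K
  obtain ⟨P, hlift⟩ := hBC 2 ℚ K hprime hcptQ πQ hne hcpt
  have hRAP : P.1.IsRegularAlgebraic := hArch.isRegularAlgebraic_baseChange hcyc hprime hlift hRA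
  refine ⟨hcpt, P, hRAP, fun w hw' => ?_⟩
  -- (3) the place `v` of `ℚ` below `w` is good
  set v : HeightOneSpectrum (𝓞 ℚ) := w.under (𝓞 ℚ) with hvdef
  have hw : w.asIdeal.under (𝓞 ℚ) = v.asIdeal := rfl
  have hv : ∀ ℓ ∈ S, ((ℓ : ℕ) : 𝓞 ℚ) ∉ v.asIdeal := by
    intro ℓ hℓ hmem
    apply hw' ℓ hℓ
    rw [← hw, Ideal.under_def, Ideal.mem_comap, map_natCast] at hmem
    exact hmem
  obtain ⟨α, a, b, ha, hb, hsat, hunr, hFrob, hcongr⟩ := hgood v hv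
  -- (4) Satake at `w` (R1), (5) the Galois side at `w`
  have hsatw := hR1 2 ℚ K hprime hcptQ hcpt πQ P hlift w v α hw hsat
  have hunrw : (σ₀.restrictField K).IsUnramifiedAt w := σ₀.isUnramifiedAt_restrictField hw hunr
  have hFrobw := σ₀.hasFrobCharpolyAt_restrictField_fin_two (E := K) hw hunr hFrob
  refine ⟨_, _, hsatw, hunrw, hFrobw, ?_⟩
  -- (6) the congruence at `w`, `q_w = q_v ^ f`, `f ∈ {1, 2}`
  rw [residueCard_eq_pow_inertiaDeg_of_under_eq hw]
  rcases inertiaDeg_eq_one_or_two_of_finrank_eq_two hK v w hw with hf | hf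
  · rw [hf]
    simpa only [pow_one, Multiset.map_id'] using hcongr
  · rw [hf]
    exact arithFrobPolyOfSatake_congr_sq ι hsat.card_eq ha hb hcongr

end Summit.Langlands.Langlands.Cruxes.ResidualBianchiDoorLevel.Sketch

end
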